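import Literature.NumberTheory.EllipticCurves.Rank1Residual.Typed.KolyvaginCertificate
import Summits.BirchSwinnertonDyer.Rank1Residual.X11b.ChaPairsMinimality
import Summits.BirchSwinnertonDyer.Rank1Residual.X11b.CertificateCheckBridge
import Summits.BirchSwinnertonDyer.Rank1Residual.X11b.KrausMinimalityGeneralTwo
import Summits.BirchSwinnertonDyer.BirchSwinnertonDyer.Theorems.Rank1ResidualIntModelSurjectivity
import Summits.BirchSwinnertonDyer.BirchSwinnertonDyer.Theorems.Rank1ResidualX11RankOneMinimality
import Summits.BirchSwinnertonDyer.BirchSwinnertonDyer.Theorems.Rank1ResidualIntModelReduction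
import HarnessLib

/-!
# BSD rank-≤1 residual cell, class X4 at a prime `p ≥ 5`, rank one: the KIT of the Kolyvagin HEEGNER-INDEX records
# at a GENERAL prime — `BSD(E,p)` for a literal integer model from kernel-decidable model checks, three Serre witness
# COUNTS mod `p`, the published named facts and the per-pair Heegner-index certificate

HONEST FRAMING (cell `b2b-bsdres-*`, verbatim): prove what is provable now; shrink each hard class to its core with
data; no claim beyond stated classes; COMBINATION classes deleted from PUBLISHED theorems only, CONSTRUCTION-shaped
remainder typed; this is not "finishing BSD". Class X4 stays CONSTRUCTION-SHAPED; PER PAIR; nothing booked; no named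
fact introduced; no definition. Unit `b2b-bsdres-x11c`, GEN 27 (prover-b2b-bsdres-x11c-g27-0).

WHAT THIS FILE IS: the unit's GEN 26 packaging theorems `bsdp_five_of_kolyvaginIndex_of_serreCounts[_support]`
(`X4/KolyvaginIndexRecordsKit[Support].lean`, p386950 / p387276) with the prime `5` replaced by a PARAMETER `p ≥ 5`
(the two tree theorems they compose — Serre's Prop. 19 from witness counts,
`IntModel.hasSurjectiveModNGaloisRep_of_intModel_of_serreWitnesses` (`5 ≤ p`), and the class-agnostic consumer
`Typed.bsdp_of_kolyvagin_of_not_dvd_index` (`p ≠ 2`; Kolyvagin as printed by McCallum 1991 §1 / Gross 1991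
Prop. 2.1 (2): named facts `kolyvagin`, `Kolyvagin1990_padicValNat_card_sha_le`; NO hypothesis on the reduction of `E`
at `p`) — are already stated at a general prime), so that the unit's per-pair Kolyvagin-index records at the additive
primes `p = 7, 11, 13, 17, …` (`X4/KolyvaginIndexRecordsOddPrimeRankOneNN.lean`) are one short theorem each:
  `bsdp_prime_of_kolyvaginIndex_of_serreCounts`: for `W = [a₁,…,a₆]` (integers): `Δ ≠ 0` and the bounded Kraus
  criterion (`X11RankOne.isGloballyMinimal_of_krausCriterion_bounded`) give `IsElliptic` / `IsGloballyMinimal`;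
  three witness primes `ℓᵢ ∉ {2, p}`, `ℓᵢ ∤ Δ`, with the schema's kernel-evaluable `countPoints [a₁,…,a₆] ℓᵢ = nᵢ`
  (`X11RankOneCertificates/Schema.lean`; CORRECT by `X11b/CertificateCheckBridge.natCard_point_eq_countPoints`) and
  Serre's three conditions mod `p` on `aᵢ = ℓᵢ + 1 − nᵢ` give `ρ̄_{E,p}` ONTO (Serre 1972 Prop. 19); then the consumer
  turns the Heegner datum (`K` imaginary quadratic with the Heegner hypothesis for the level `N`, `P = y_K` of
  infinite order, `p ∤ [E(K):ℤP]`), `r_an ≤ 1` and `#Ш_an = q` with `ord_p q = 0` into Miller's `BSD(E,p)`;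
  `bsdp_prime_of_kolyvaginIndex_of_serreCounts_support`: the same with global minimality from the SUPPORT of `Δ`
  (`X11b.isGloballyMinimal_of_krausCriterion_support`, no size bound; for models with `|Δ| ≥ 512¹²` or a Kraus
  pattern at `2` outside the bounded list).
Every numeric hypothesis is a `decide` goal for a literal record; every other hypothesis is a displayed binder of the
record theorem. Nothing about any particular curve is asserted here.

References: Serre 1972 §2.8 Prop. 19 [Serre1972]; McCallum 1991 §1 [McCallumLMS1991]; Gross 1991 Prop. 2.1
[GrossLMS1991]; Miller 2011 Def. 1.1 [Miller2011LMS]; Kraus 1989 Prop. 1–2 [Kraus1989]; Silverman AEC VII.1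
Remark 1.1, VIII.8 [SilvermanAEC2009]; Ireland–Rosen Prop. 5.1.2 [IrelandRosen1990].
-/

set_option autoImplicit false

noncomputable section

open scoped Classical

open WeierstrassCurve Literature.NumberTheory.EllipticCurves
  Literature.NumberTheory.EllipticCurves.Rank1Residual
  Literature.NumberTheory.EllipticCurves.Rank1Residual.Typed
  Literature.NumberTheory.EllipticCurves.Rank1Residual.X11RankOneCertificates
  Summit.BirchSwinnertonDyer.BirchSwinnertonDyer.Rank1Residual.IntModel
  Summit.BirchSwinnertonDyer.BirchSwinnertonDyer.Rank1Residual.X11RankOne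

namespace Summit.BirchSwinnertonDyer.Rank1Residual.X4

/-- **`BSD(E,p)` at a prime `p ≥ 5` for a literal integer model from the Kolyvagin HEEGNER-INDEX certificate.**
Inputs: (kernel, `decide` goals for a record) `Δ ≠ 0`, `|Δ| < 512¹²` and the bounded Kraus disjunction below `512`
(⇒ `IsElliptic`, `IsGloballyMinimal`); three primes `ℓ₁, ℓ₂, ℓ₃ ∉ {2,p}` not dividing `Δ` with `countPoints = nᵢ`
and, for `aᵢ = ℓᵢ + 1 − nᵢ` mod `p`: (s₁) `a₁² − 4ℓ₁` a non-zero square and `a₁ ≠ 0`, (s₂) `a₂² − 4ℓ₂` a non-square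
and `a₂ ≠ 0`, (s₃) `a₃² = uℓ₃` with `u ∉ {0,1,2,4}`, `u² − 3u + 1 ≠ 0` (⇒ `ρ̄_{E,p}` onto, Serre Prop. 19); (binders)
GZK `hGZK`, Kolyvagin as printed (`hKo`, `hB`), the Heegner datum `K`, `N`, `P` with `p ∤ [E(K):ℤP]`, `r_an ≤ 1`,
`#Ш_an = q` with `ord_p q = 0`. Output: Miller's `BSD(E,p)` (`Typed.bsdp_of_kolyvagin_of_not_dvd_index`). The
GEN 26 theorem `bsdp_five_of_kolyvaginIndex_of_serreCounts` is the case `p = 5`. Per pair; no class statement.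
[cite: Serre1972, §2.8 Prop. 19] [cite: McCallumLMS1991, §1 Theorem (Kolyvagin), p. 296]
[cite: GrossLMS1991, §2 Prop. 2.1 (2)] [cite: Miller2011LMS, §1 and Def. 1.1] [cite: SilvermanAEC2009, VII.1 Remark 1.1] -/
theorem bsdp_prime_of_kolyvaginIndex_of_serreCounts (p : ℕ) (hp : p.Prime) (hp5 : 5 ≤ p) (a1 a2 a3 a4 a6 : ℤ)
    (h0 : discOf [a1, a2, a3, a4, a6] ≠ 0) (h512 : (discOf [a1, a2, a3, a4, a6]).natAbs < 512 ^ 12)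
    (hKraus : ∀ q < 512, q < 2 ∨ ¬ q ^ 12 ∣ (discOf [a1, a2, a3, a4, a6]).natAbs ∨
      ¬ q ^ 4 ∣ (c4Of [a1, a2, a3, a4, a6]).natAbs ∨
      (q = 2 ∧ ¬ (2 : ℤ) ^ 8 ∣ c4Of [a1, a2, a3, a4, a6] ∧ (2 : ℤ) ^ 7 ∣ c6Of [a1, a2, a3, a4, a6]) ∨
      (q = 2 ∧ ¬ (2 : ℤ) ^ 24 ∣ discOf [a1, a2, a3, a4, a6] ∧ (512 : ℤ) ∣ c6Of [a1, a2, a3, a4, a6] ∧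
        (4 : ℤ) ∣ c6Of [a1, a2, a3, a4, a6] / 512 - 3) ∨
      (q = 3 ∧ (3 : ℤ) ^ 8 ∣ c6Of [a1, a2, a3, a4, a6] ∧ ¬ (3 : ℤ) ^ 9 ∣ c6Of [a1, a2, a3, a4, a6]))
    (ℓ₁ ℓ₂ ℓ₃ : ℕ) (hp₁ : ℓ₁.Prime) (hp₂ : ℓ₂.Prime) (hp₃ : ℓ₃.Prime)
    (h2₁ : ℓ₁ ≠ 2) (h2₂ : ℓ₂ ≠ 2) (h2₃ : ℓ₃ ≠ 2) (hne₁ : ℓ₁ ≠ p) (hne₂ : ℓ₂ ≠ p) (hne₃ : ℓ₃ ≠ p)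
    (hΔ₁ : ¬ (ℓ₁ : ℤ) ∣ (⟨a1, a2, a3, a4, a6⟩ : WeierstrassCurve ℤ).Δ)
    (hΔ₂ : ¬ (ℓ₂ : ℤ) ∣ (⟨a1, a2, a3, a4, a6⟩ : WeierstrassCurve ℤ).Δ)
    (hΔ₃ : ¬ (ℓ₃ : ℤ) ∣ (⟨a1, a2, a3, a4, a6⟩ : WeierstrassCurve ℤ).Δ)
    {n₁ n₂ n₃ : ℕ} (hc₁ : countPoints [a1, a2, a3, a4, a6] ℓ₁ = n₁)
    (hc₂ : countPoints [a1, a2, a3, a4, a6] ℓ₂ = n₂) (hc₃ : countPoints [a1, a2, a3, a4, a6] ℓ₃ = n₃)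
    (hi : IsSquare ((((ℓ₁ : ℤ) + 1 - n₁ : ℤ) : ZMod p) ^ 2 - 4 * ℓ₁) ∧
      (((ℓ₁ : ℤ) + 1 - n₁ : ℤ) : ZMod p) ^ 2 - 4 * ℓ₁ ≠ 0 ∧ (((ℓ₁ : ℤ) + 1 - n₁ : ℤ) : ZMod p) ≠ 0)
    (hii : ¬ IsSquare ((((ℓ₂ : ℤ) + 1 - n₂ : ℤ) : ZMod p) ^ 2 - 4 * ℓ₂) ∧
      (((ℓ₂ : ℤ) + 1 - n₂ : ℤ) : ZMod p) ≠ 0)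
    (hiii : ∃ u : ZMod p, (((ℓ₃ : ℤ) + 1 - n₃ : ℤ) : ZMod p) ^ 2 = u * ℓ₃ ∧
      u ≠ 0 ∧ u ≠ 1 ∧ u ≠ 2 ∧ u ≠ 4 ∧ u ^ 2 - 3 * u + 1 ≠ 0)
    (hGZK : rank_eq_analyticRank_of_analyticRank_le_one)
    (W : WeierstrassCurve ℚ) (hW : W = ⟨a1, a2, a3, a4, a6⟩)
    {N : ℕ} [NeZero N] {K : Type} [Field K] [NumberField K] (hKo : kolyvagin N W K)
    (hB : Kolyvagin1990_padicValNat_card_sha_le N W K) (hK : IsImaginaryQuadratic K)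
    (hH : SatisfiesHeegnerHypothesis N K) {P : (W.baseChange K).toAffine.Point}
    (hP : IsHeegnerPoint N W K P) (hnt : ¬ IsOfFinAddOrder P)
    (hI : ¬ p ∣ (AddSubgroup.zmultiples P).index)
    (hr : W.analyticRank ≤ 1) {q : ℚ} (hq : shaAn W = (q : ℂ)) (hv : padicValRat p q = 0) :
    BSDp W p := by
  subst hW
  haveI hE : (⟨a1, a2, a3, a4, a6⟩ : WeierstrassCurve ℚ).IsElliptic :=
    X11b.isElliptic_of_discOf_ne_zero a1 a2 a3 a4 a6 h0
  haveI hM : (⟨a1, a2, a3, a4, a6⟩ : WeierstrassCurve ℚ).IsGloballyMinimal :=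
    isGloballyMinimal_of_krausCriterion_bounded a1 a2 a3 a4 a6 h0 h512 hKraus
  haveI : Fact (Nat.Prime p) := ⟨hp⟩
  haveI := Fact.mk hp₁; haveI := Fact.mk hp₂; haveI := Fact.mk hp₃
  have hp2 : p ≠ 2 := by omega
  have hI0 : integralModelInt (⟨a1, a2, a3, a4, a6⟩ : WeierstrassCurve ℚ) = ⟨a1, a2, a3, a4, a6⟩ :=
    integralModelInt_eq_of_map_eq _ (map_mk_int a1 a2 a3 a4 a6)
  -- the three witness counts in `Nat.card` form (the schema's `countPoints` is CORRECT:
  -- `X11b.natCard_point_eq_countPoints`)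
  have hn₁ : Nat.card (((⟨a1, a2, a3, a4, a6⟩ : WeierstrassCurve ℤ).map
      (Int.castRingHom (ZMod ℓ₁))).toAffine.Point) = n₁ := by
    exact_mod_cast (X11b.natCard_point_eq_countPoints a1 a2 a3 a4 a6 ℓ₁ h2₁ hΔ₁).trans hc₁
  have hn₂ : Nat.card (((⟨a1, a2, a3, a4, a6⟩ : WeierstrassCurve ℤ).map
      (Int.castRingHom (ZMod ℓ₂))).toAffine.Point) = n₂ := by
    exact_mod_cast (X11b.natCard_point_eq_countPoints a1 a2 a3 a4 a6 ℓ₂ h2₂ hΔ₂).trans hc₂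
  have hn₃ : Nat.card (((⟨a1, a2, a3, a4, a6⟩ : WeierstrassCurve ℤ).map
      (Int.castRingHom (ZMod ℓ₃))).toAffine.Point) = n₃ := by
    exact_mod_cast (X11b.natCard_point_eq_countPoints a1 a2 a3 a4 a6 ℓ₃ h2₃ hΔ₃).trans hc₃
  have hρ : (⟨a1, a2, a3, a4, a6⟩ : WeierstrassCurve ℚ).HasSurjectiveModNGaloisRep p :=
    hasSurjectiveModNGaloisRep_of_intModel_of_serreWitnesses hI0 p hp5 ℓ₁ ℓ₂ ℓ₃ hne₁ hne₂ hne₃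
      hΔ₁ hΔ₂ hΔ₃ hn₁ hn₂ hn₃ hi hii hiii
  exact bsdp_of_kolyvagin_of_not_dvd_index _ p hGZK hKo hB hK hH hP hnt hp2 hρ hI hr hq hv

/-- **`BSD(E,p)` at a prime `p ≥ 5` for a literal integer model from the Kolyvagin HEEGNER-INDEX certificate —
SUPPORT form.** As `bsdp_prime_of_kolyvaginIndex_of_serreCounts`, with global minimality from the support `bad` of `Δ`
(`|Δ| = ∏ q^{v_q Δ}`, each `q` prime) and the per-prime Kraus/Silverman test
(`X11b.isGloballyMinimal_of_krausCriterion_support`; no size bound on `Δ`). The GEN 26 theorem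
`bsdp_five_of_kolyvaginIndex_of_serreCounts_support` is the case `p = 5`. Per pair; no class statement.
[cite: Serre1972, §2.8 Prop. 19] [cite: McCallumLMS1991, §1 Theorem (Kolyvagin), p. 296]
[cite: GrossLMS1991, §2 Prop. 2.1 (2)] [cite: Miller2011LMS, §1 and Def. 1.1] [cite: Kraus1989, Prop. 1 and Prop. 2]
[cite: SilvermanAEC2009, VII.1 Remark 1.1 and VIII.8] -/
theorem bsdp_prime_of_kolyvaginIndex_of_serreCounts_support (p : ℕ) (hp : p.Prime) (hp5 : 5 ≤ p)
    (a1 a2 a3 a4 a6 : ℤ)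
    (h0 : discOf [a1, a2, a3, a4, a6] ≠ 0) (bad : List (ℕ × ℕ × ℕ)) (hprime : ∀ t ∈ bad, t.1.Prime)
    (hsupp : (discOf [a1, a2, a3, a4, a6]).natAbs = (bad.map fun t => t.1 ^ t.2.2).prod)
    (hmin : ∀ t ∈ bad,
      (¬ (t.1 : ℤ) ^ 12 ∣ discOf [a1, a2, a3, a4, a6] ∨ ¬ (t.1 : ℤ) ^ 4 ∣ c4Of [a1, a2, a3, a4, a6]) ∨
      (t.1 = 2 ∧ (16 : ℤ) ∣ c4Of [a1, a2, a3, a4, a6] ∧ (64 : ℤ) ∣ c6Of [a1, a2, a3, a4, a6] ∧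
        ¬ (((16 : ℤ) ∣ c4Of [a1, a2, a3, a4, a6] / 16 ∧
            ((32 : ℤ) ∣ c6Of [a1, a2, a3, a4, a6] / 64 ∨ (32 : ℤ) ∣ c6Of [a1, a2, a3, a4, a6] / 64 - 8)) ∨
          (4 : ℤ) ∣ c6Of [a1, a2, a3, a4, a6] / 64 + 1)) ∨
      (t.1 = 3 ∧ (3 : ℤ) ^ 8 ∣ c6Of [a1, a2, a3, a4, a6] ∧ ¬ (3 : ℤ) ^ 9 ∣ c6Of [a1, a2, a3, a4, a6]))
    (ℓ₁ ℓ₂ ℓ₃ : ℕ) (hp₁ : ℓ₁.Prime) (hp₂ : ℓ₂.Prime) (hp₃ : ℓ₃.Prime)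
    (h2₁ : ℓ₁ ≠ 2) (h2₂ : ℓ₂ ≠ 2) (h2₃ : ℓ₃ ≠ 2) (hne₁ : ℓ₁ ≠ p) (hne₂ : ℓ₂ ≠ p) (hne₃ : ℓ₃ ≠ p)
    (hΔ₁ : ¬ (ℓ₁ : ℤ) ∣ (⟨a1, a2, a3, a4, a6⟩ : WeierstrassCurve ℤ).Δ)
    (hΔ₂ : ¬ (ℓ₂ : ℤ) ∣ (⟨a1, a2, a3, a4, a6⟩ : WeierstrassCurve ℤ).Δ)
    (hΔ₃ : ¬ (ℓ₃ : ℤ) ∣ (⟨a1, a2, a3, a4, a6⟩ : WeierstrassCurve ℤ).Δ)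
    {n₁ n₂ n₃ : ℕ} (hc₁ : countPoints [a1, a2, a3, a4, a6] ℓ₁ = n₁)
    (hc₂ : countPoints [a1, a2, a3, a4, a6] ℓ₂ = n₂) (hc₃ : countPoints [a1, a2, a3, a4, a6] ℓ₃ = n₃)
    (hi : IsSquare ((((ℓ₁ : ℤ) + 1 - n₁ : ℤ) : ZMod p) ^ 2 - 4 * ℓ₁) ∧
      (((ℓ₁ : ℤ) + 1 - n₁ : ℤ) : ZMod p) ^ 2 - 4 * ℓ₁ ≠ 0 ∧ (((ℓ₁ : ℤ) + 1 - n₁ : ℤ) : ZMod p) ≠ 0)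
    (hii : ¬ IsSquare ((((ℓ₂ : ℤ) + 1 - n₂ : ℤ) : ZMod p) ^ 2 - 4 * ℓ₂) ∧
      (((ℓ₂ : ℤ) + 1 - n₂ : ℤ) : ZMod p) ≠ 0)
    (hiii : ∃ u : ZMod p, (((ℓ₃ : ℤ) + 1 - n₃ : ℤ) : ZMod p) ^ 2 = u * ℓ₃ ∧
      u ≠ 0 ∧ u ≠ 1 ∧ u ≠ 2 ∧ u ≠ 4 ∧ u ^ 2 - 3 * u + 1 ≠ 0)
    (hGZK : rank_eq_analyticRank_of_analyticRank_le_one)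
    (W : WeierstrassCurve ℚ) (hW : W = ⟨a1, a2, a3, a4, a6⟩)
    {N : ℕ} [NeZero N] {K : Type} [Field K] [NumberField K] (hKo : kolyvagin N W K)
    (hB : Kolyvagin1990_padicValNat_card_sha_le N W K) (hK : IsImaginaryQuadratic K)
    (hH : SatisfiesHeegnerHypothesis N K) {P : (W.baseChange K).toAffine.Point}
    (hP : IsHeegnerPoint N W K P) (hnt : ¬ IsOfFinAddOrder P)
    (hI : ¬ p ∣ (AddSubgroup.zmultiples P).index)
    (hr : W.analyticRank ≤ 1) {q : ℚ} (hq : shaAn W = (q : ℂ)) (hv : padicValRat p q = 0) :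
    BSDp W p := by
  subst hW
  haveI hE : (⟨a1, a2, a3, a4, a6⟩ : WeierstrassCurve ℚ).IsElliptic :=
    X11b.isElliptic_of_discOf_ne_zero a1 a2 a3 a4 a6 h0
  haveI hM : (⟨a1, a2, a3, a4, a6⟩ : WeierstrassCurve ℚ).IsGloballyMinimal :=
    X11b.isGloballyMinimal_of_krausCriterion_support a1 a2 a3 a4 a6 bad hprime hsupp hmin
  haveI : Fact (Nat.Prime p) := ⟨hp⟩
  haveI := Fact.mk hp₁; haveI := Fact.mk hp₂; haveI := Fact.mk hp₃
  have hp2 : p ≠ 2 := by omega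
  have hI0 : integralModelInt (⟨a1, a2, a3, a4, a6⟩ : WeierstrassCurve ℚ) = ⟨a1, a2, a3, a4, a6⟩ :=
    integralModelInt_eq_of_map_eq _ (map_mk_int a1 a2 a3 a4 a6)
  have hn₁ : Nat.card (((⟨a1, a2, a3, a4, a6⟩ : WeierstrassCurve ℤ).map
      (Int.castRingHom (ZMod ℓ₁))).toAffine.Point) = n₁ := by
    exact_mod_cast (X11b.natCard_point_eq_countPoints a1 a2 a3 a4 a6 ℓ₁ h2₁ hΔ₁).trans hc₁
  have hn₂ : Nat.card (((⟨a1, a2, a3, a4, a6⟩ : WeierstrassCurve ℤ).map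
      (Int.castRingHom (ZMod ℓ₂))).toAffine.Point) = n₂ := by
    exact_mod_cast (X11b.natCard_point_eq_countPoints a1 a2 a3 a4 a6 ℓ₂ h2₂ hΔ₂).trans hc₂
  have hn₃ : Nat.card (((⟨a1, a2, a3, a4, a6⟩ : WeierstrassCurve ℤ).map
      (Int.castRingHom (ZMod ℓ₃))).toAffine.Point) = n₃ := by
    exact_mod_cast (X11b.natCard_point_eq_countPoints a1 a2 a3 a4 a6 ℓ₃ h2₃ hΔ₃).trans hc₃
  have hρ : (⟨a1, a2, a3, a4, a6⟩ : WeierstrassCurve ℚ).HasSurjectiveModNGaloisRep p :=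
    hasSurjectiveModNGaloisRep_of_intModel_of_serreWitnesses hI0 p hp5 ℓ₁ ℓ₂ ℓ₃ hne₁ hne₂ hne₃
      hΔ₁ hΔ₂ hΔ₃ hn₁ hn₂ hn₃ hi hii hiii
  exact bsdp_of_kolyvagin_of_not_dvd_index _ p hGZK hKo hB hK hH hP hnt hp2 hρ hI hr hq hv

end Summit.BirchSwinnertonDyer.Rank1Residual.X4

end
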